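/-
Copyright: the b2b-balaban T⁴-continuum CRUX team, row NE7b OWNER lineage `t4-ne7b-p1` (gen 134). Project licence.
-/
import Summits.QuantumFields.BalabanUV.T4Continuum.Spine.NE7b.SupClusterSupportRegrouping

/-!
# THE STEP IS LINEAR AND NORM-BOUNDED IN THE PINNED KOTECKÝ–PREISS NORMS — NO SUP LETTERS, NO POWER LOSS: measure an activity `z` on cell sets by
# its norm pinned at a cell, `N_a(q) := Σ_{Y ∈ L touching {q}} ‖z Y‖e^{a#Y}`, and the regrouped output of (354) by the same norm of its support
# terms, `N⁺_a(q) := Σ_{Y touching {q}} ‖K⁺(Y)‖e^{a#Y}` (`K⁺(Y) = Σ_{𝒞 ⊆ L, ⋃𝒞 = Y}Φ^T(𝒞)`).  Then, for nonempty polymers and `R` symmetric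
# with `≤ Δ` neighbours, under the single hypothesis `sup_q N_{1+τ}(q) ≤ η ≤ 1` (which IS the Kotecký–Preiss condition with `a = #`, `d = τ#`):
#   `Σ_{Y ∋ p}‖K⁺(Y)‖e^{τ#Y} ≤ Σ_{Y' ∈ L, Y' ≁ {p}}‖z Y'‖e^{(1+τ)#Y'} ≤ η`   and   `sup_q N⁺_τ(q) ≤ (Δ+1)·η`:
# the fluctuation step `z ↦ K⁺` is a LINEAR map of norm `≤ Δ+1` from weight `1+τ` to weight `τ` — the honest letter map of SCOPING-d5's closure,
# replacing the sup-letter chain `ε ↦ √ε·e^{2√ε} ↦ (√·)` of (350)∕(354) (which loses a power per step) by a bound LINEAR in the input; what the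
# step does NOT regenerate is the WEIGHT (`1+τ ↦ τ`): that is where blocking ∕ rescaling must enter (NC-NE7b-α, untouched) (row NE7b, node U5c;
# the tree's `touchSum_le_of_forall_scaleAt` ∕ `touchSum_smul_le_of_kp` + (354) BY NAME; [folklore])

Cell `pub-balaban`, sub-cell `t4`, spine estimate NE7b (`T4WeightBudget.RelWeightBound`; the cell's OWN estimate — NOT PRINTED in
[Bałaban 1983–89], NOT PROVED).  Crux-route work under `Spine/NE7b/` by the row OWNER (`t4-ne7b-p1` gen 134, file (356)) under FREEZE
(0)'s crux-prover clause, on `g131/records/SCOPING-d5-reentry.md` DECISION (3) («the letter map (ε, τ) ↦ (ε⁺, τ⁺)»); NOTHING of Bałaban's is named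
as a Lean object, valued or asserted; no `T4Continuum/Support` leaf typed; no `def`, no notation (the norms are displayed sums); zero `sorry`.
Imports (BY NAME): the OWNER's (354) `…SupClusterSupportRegrouping` (`kpTouches_singleton_of_biUnion_eq`, `card_le_clusterSize_of_biUnion_eq`); the
tree's `ClusterExpansionKPBound` (`touchSum`, `touchSum_le_of_forall_scaleAt`, `touchSum_smul_le_of_kp`, `multCube`, `mem_multCube`),
`ClusterExpansionActivityPaths` (`scaledActivity_one`, `scaleAt_mem_Icc`), `ClusterExpansion` (`IsKPVolume`, `kpTerm`, `truncatedWeight`, `KPTouches`),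
`PolymerGasGeometric` (`Touches`, `GeomInc`), `LocalPerturbationClusterExpansion` (`instReflGeomInc`, `instSymmGeomInc`); Mathlib's
`Finset.sum_fiberwise_eq_sum_filter`, `Finset.card_insert_le`.

WHY (located).  (350) paid `ε ↦ √ε` to count covers and (354) paid `ε′ ↦ √ε′` to convert the `e^{−τ#Y}` decay into a geometric sup letter; composed,
the sup letter of the class degrades like `ε ↦ ε^{1∕4}` per step, so the sup-letter format closes but does not iterate boundedly.  The Kotecký–Preiss
theorem, however, is LINEAR at the level of pinned weighted sums — `Σ_{𝒞 pinned at X}‖Φ^T(𝒞)‖e^{d(𝒞)} ≤ Σ_{δ ≁ X}‖z δ‖e^{a(δ)+d(δ)}` — and the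
regrouping by support preserves pinning.  In these norms the step costs a factor `Δ+1` (the closed neighbourhood of the pin) and one unit of
weight, nothing else; the remaining non-closure is the weight shift, i.e. exactly the absence of rescaling on this road.

WHAT IS PROVED ([folklore]; `R` symmetric; weight `τ ≥ 0`):
* §1 `isKPVolume_of_normKP` (the norm-form KP hypothesis gives the tree's `IsKPVolume`), **`touchSum_le_pinnedNorm`** (`Σ_{𝒞 ⊆ L pinned at X}‖Φ^T(𝒞)‖e^{τ‖𝒞‖}
  ≤ Σ_{Y' ∈ L, Y' ≁ X}‖z Y'‖e^{(1+τ)#Y'}` for EVERY cell set `X`), `normKP_of_uniform` (`sup_q N_{1+τ}(q) ≤ η ≤ 1`, polymers nonempty ⟹ the norm-form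
  KP hypothesis);
* §2 THE LINEAR STEP: `sum_weighted_supportTerm_le_touchSum` (`Σ_{Y∈T, p∈Y}‖K⁺(Y)‖e^{τ#Y} ≤` the pinned cluster sum at `{p}`), THE END
  **`outputNorm_le_inputNorm`** (`Σ_{Y∈T, p∈Y}‖K⁺(Y)‖e^{τ#Y} ≤ Σ_{Y'∈L, Y' ≁ {p}}‖z Y'‖e^{(1+τ)#Y'}`), **`outputNorm_le_of_uniform`** (`≤ η`) and
  **`outputTouchNorm_le`** (`Σ_{Y∈T, Y touching {q}}‖K⁺(Y)‖e^{τ#Y} ≤ (Δ+1)η` — the output in the INPUT's own norm, one unit of weight lower); §3 toy.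

HONEST (what this is NOT).  Abstract activity level; the weight shift `1+τ ↦ τ` is NOT repaired (no rescaling: NC-NE7b-α UNRULED), so `k` steps need
initial weight `τ₀ ≥ k`; converting the road's factor letters ((351)∕(355)) into `N_{1+τ}` is the cover-counting step of (350) done with weights (not
typed here); scalar skeleton ((A3)); nothing of Bałaban's asserted.  BY-NAME EFFECT ON THE WALL: NONE.  NE7b NOT PRINTED ∕ NOT PROVED; spine PROVED
0∕9; rung (B)+1 — the programme's measures remain FINITE-torus statements; NOT the mass gap, NOT Clay.  HONEST DEPENDENCY: continuum YM on T⁴ ⇐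
BetaPertH ∧ nine spine estimates (0∕9 proved); BetaPertH ⇐ (D1) ∧ (D4) ∧ CAP+tail; G-an2-4 gates asym, D1 and NE2∕3∕4.
-/

set_option autoImplicit false

noncomputable section

namespace Summit.QuantumFields.BalabanUV.T4Continuum.NE7b.SupStepKPNormLinear

open Finset Real
open scoped BigOperators
open Literature.Probability.LatticeModels
open SupClusterSupportRegrouping (kpTouches_singleton_of_biUnion_eq card_le_clusterSize_of_biUnion_eq)

variable {V : Type*} [DecidableEq V] {R : V → V → Prop} [DecidableRel R] {z : Finset V → ℂ} {τ η : ℝ} {nbr : V → Finset V} {Δ : ℕ}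

/-! ## §1. The Kotecký–Preiss bound in norm form -/

/-- **The norm-form KP hypothesis gives the tree's `IsKPVolume`** (drop the decay weight `τ#Y' ≥ 0`). [folklore] -/
theorem isKPVolume_of_normKP (hτ : 0 ≤ τ) {L : Finset (Finset V)}
    (hKP : ∀ Y ∈ L, ∑ Y' ∈ L with GeomInc R Y' Y, ‖z Y'‖ * Real.exp ((Y'.card : ℝ) + τ * (Y'.card : ℝ)) ≤ (Y.card : ℝ)) :
    IsKPVolume (GeomInc R) z (fun Y => (Y.card : ℝ)) L := fun Y hY => by
  refine le_trans (sum_le_sum fun Y' _ => ?_) (hKP Y hY)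
  unfold kpTerm
  exact mul_le_mul_of_nonneg_left (exp_le_exp.2 (le_add_of_nonneg_right (by positivity))) (norm_nonneg _)

/-- **THE PINNED CLUSTER SUMS ARE BOUNDED LINEARLY BY THE PINNED INPUT NORM**: `R` symmetric, `0 ≤ τ`, the norm-form KP hypothesis
`Σ_{Y'∈L, Y' ≁ Y}‖z Y'‖e^{(1+τ)#Y'} ≤ #Y` on `L` ⟹ for EVERY cell set `X`,
`Σ_{𝒞 ⊆ L pinned at X}‖Φ^T(𝒞)‖e^{τ‖𝒞‖} ≤ Σ_{Y'∈L, Y' ≁ X}‖z Y'‖e^{#Y' + τ#Y'}` ([KP86, (4)] read as a linear bound). [folklore] -/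
theorem touchSum_le_pinnedNorm (hR : ∀ x y, R x y → R y x) (hτ : 0 ≤ τ) {L : Finset (Finset V)}
    (hKP : ∀ Y ∈ L, ∑ Y' ∈ L with GeomInc R Y' Y, ‖z Y'‖ * Real.exp ((Y'.card : ℝ) + τ * (Y'.card : ℝ)) ≤ (Y.card : ℝ)) (X : Finset V) :
    ∑ 𝒞 ∈ L.powerset with KPTouches (GeomInc R) 𝒞 X, ‖truncatedWeight (GeomInc R) z 𝒞‖ * Real.exp (∑ Y ∈ 𝒞, τ * (Y.card : ℝ)) ≤
      ∑ Y' ∈ L with GeomInc R Y' X, ‖z Y'‖ * Real.exp ((Y'.card : ℝ) + τ * (Y'.card : ℝ)) := by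
  haveI : Std.Symm R := ⟨hR⟩
  have ha : ∀ γ : Finset V, 0 ≤ (γ.card : ℝ) := fun γ => Nat.cast_nonneg _
  have hd : ∀ γ : Finset V, 0 ≤ (fun Y : Finset V => τ * (Y.card : ℝ)) γ := fun γ => by positivity
  have h1 : ∀ γ ∈ L, ∑ γ' ∈ L with GeomInc R γ' γ,
      ‖z γ'‖ * Real.exp ((γ'.card : ℝ) + (fun Y : Finset V => τ * (Y.card : ℝ)) γ') ≤ (γ.card : ℝ) := hKP
  have hS : ∀ t ∈ Set.Icc (0 : ℝ) 1, ∀ δ ∈ L, GeomInc R δ X →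
      touchSum (GeomInc R) (scaledActivity z (scaleAt (GeomInc R) (fun _ => (1 : ℝ)) X t)) (fun Y : Finset V => τ * (Y.card : ℝ)) L δ
        ≤ (δ.card : ℝ) := by
    intro t ht δ hδ _
    have hc : scaleAt (GeomInc R) (fun _ => (1 : ℝ)) X t ∈ multCube (Finset V) 1 :=
      mem_multCube.2 fun δ' => scaleAt_mem_Icc (fun _ => ⟨zero_le_one, le_rfl⟩) X ht δ'
    have := touchSum_smul_le_of_kp ha hd h1 1 ⟨zero_le_one, le_rfl⟩ _ hc δ hδ
    rwa [one_smul] at this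
  have hmain := touchSum_le_of_forall_scaleAt (inc := GeomInc R) hd (isKPVolume_of_normKP hτ hKP) (c := fun _ => (1 : ℝ))
    (fun _ => ⟨zero_le_one, le_rfl⟩) (γ := X) hS
  rw [scaledActivity_one] at hmain
  exact hmain

omit [DecidableEq V] [DecidableRel R] in
/-- A polymer geometrically incompatible with a nonempty `Y` touches a singleton `{q}`, `q ∈ Y`. [folklore] -/
theorem exists_touches_singleton_of_geomInc {Y' Y : Finset V} (hY : Y.Nonempty) (h : GeomInc R Y' Y) : ∃ q ∈ Y, Touches R Y' {q} := by
  rcases h with rfl | ⟨w, hw, q, hq, hwq⟩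
  · obtain ⟨q, hq⟩ := hY
    exact ⟨q, hq, q, hq, q, mem_singleton_self q, Or.inl rfl⟩
  · exact ⟨q, hq, w, hw, q, mem_singleton_self q, hwq⟩

/-- **THE UNIFORM PINNED NORM BOUND GIVES THE KP HYPOTHESIS**: polymers of `L` nonempty, `sup_q Σ_{Y'∈L touching {q}}‖z Y'‖e^{(1+τ)#Y'} ≤ η ≤ 1` ⟹
`Σ_{Y'∈L, Y' ≁ Y}‖z Y'‖e^{#Y'+τ#Y'} ≤ #Y` for every `Y ∈ L` (each incompatible `Y'` touches a singleton of `Y`). [folklore] -/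
theorem normKP_of_uniform (hτ : 0 ≤ τ) {L : Finset (Finset V)} (hL : ∀ Y ∈ L, Y.Nonempty)
    (hN : ∀ q : V, ∑ Y' ∈ L with Touches R Y' {q}, ‖z Y'‖ * Real.exp ((1 + τ) * (Y'.card : ℝ)) ≤ η) (hη : η ≤ 1) :
    ∀ Y ∈ L, ∑ Y' ∈ L with GeomInc R Y' Y, ‖z Y'‖ * Real.exp ((Y'.card : ℝ) + τ * (Y'.card : ℝ)) ≤ (Y.card : ℝ) := by
  have _hτ := hτ
  intro Y hY
  have hform : ∀ Y' : Finset V, (Y'.card : ℝ) + τ * (Y'.card : ℝ) = (1 + τ) * (Y'.card : ℝ) := fun Y' => by ring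
  simp_rw [hform]
  calc ∑ Y' ∈ L with GeomInc R Y' Y, ‖z Y'‖ * Real.exp ((1 + τ) * (Y'.card : ℝ))
      ≤ ∑ Y' ∈ L with ∃ q ∈ Y, Touches R Y' {q}, ‖z Y'‖ * Real.exp ((1 + τ) * (Y'.card : ℝ)) :=
        sum_le_sum_of_subset_of_nonneg (fun Y' hY' => mem_filter.2 ⟨(mem_filter.1 hY').1,
          exists_touches_singleton_of_geomInc (hL Y hY) (mem_filter.1 hY').2⟩) fun _ _ _ => by positivity
    _ ≤ ∑ Y' ∈ L with ∃ q ∈ Y, Touches R Y' {q}, ∑ q ∈ Y with Touches R Y' {q}, ‖z Y'‖ * Real.exp ((1 + τ) * (Y'.card : ℝ)) := by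
        refine sum_le_sum fun Y' hY' => ?_
        obtain ⟨q, hqY, hq⟩ := (mem_filter.1 hY').2
        have hmem : q ∈ Y.filter fun q => Touches R Y' {q} := mem_filter.2 ⟨hqY, hq⟩
        calc ‖z Y'‖ * Real.exp ((1 + τ) * (Y'.card : ℝ)) = ∑ q' ∈ ({q} : Finset V), ‖z Y'‖ * Real.exp ((1 + τ) * (Y'.card : ℝ)) := by simp
          _ ≤ _ := sum_le_sum_of_subset_of_nonneg (by simpa using hmem) fun _ _ _ => by positivity
    _ ≤ ∑ Y' ∈ L, ∑ q ∈ Y with Touches R Y' {q}, ‖z Y'‖ * Real.exp ((1 + τ) * (Y'.card : ℝ)) :=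
        sum_le_sum_of_subset_of_nonneg (filter_subset _ _) fun _ _ _ => sum_nonneg fun _ _ => by positivity
    _ = ∑ q ∈ Y, ∑ Y' ∈ L with Touches R Y' {q}, ‖z Y'‖ * Real.exp ((1 + τ) * (Y'.card : ℝ)) := by
        rw [sum_comm' (t' := Y) (s' := fun q => L.filter fun Y' => Touches R Y' {q})]
        intro Y' q
        simp only [mem_filter]
        tauto
    _ ≤ ∑ _q ∈ Y, η := sum_le_sum fun q _ => hN q
    _ ≤ ∑ _q ∈ Y, (1 : ℝ) := sum_le_sum fun _ _ => hη
    _ = (Y.card : ℝ) := by simp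

/-! ## §2. THE LINEAR STEP -/

omit [DecidableRel R] in
/-- **The weighted support terms pinned at `p` are dominated by the pinned cluster sum at `{p}`** (`0 ≤ τ`; families with support `Y ∋ p` are pinned
at `{p}` and have `‖𝒞‖ ≥ #Y`). [folklore] -/
theorem sum_weighted_supportTerm_le_touchSum [DecidableRel R] (hτ : 0 ≤ τ) (L T : Finset (Finset V)) (p : V) :
    ∑ Y ∈ T with p ∈ Y, ‖∑ 𝒞 ∈ L.powerset with 𝒞.biUnion id = Y, truncatedWeight (GeomInc R) z 𝒞‖ * Real.exp (τ * Y.card) ≤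
      ∑ 𝒞 ∈ L.powerset with KPTouches (GeomInc R) 𝒞 {p}, ‖truncatedWeight (GeomInc R) z 𝒞‖ * Real.exp (∑ Y ∈ 𝒞, τ * (Y.card : ℝ)) := by
  set Φ : Finset (Finset V) → ℂ := truncatedWeight (GeomInc R) z with hΦ
  calc ∑ Y ∈ T with p ∈ Y, ‖∑ 𝒞 ∈ L.powerset with 𝒞.biUnion id = Y, Φ 𝒞‖ * Real.exp (τ * Y.card)
      ≤ ∑ Y ∈ T with p ∈ Y, ∑ 𝒞 ∈ L.powerset with 𝒞.biUnion id = Y, ‖Φ 𝒞‖ * Real.exp (∑ Y' ∈ 𝒞, τ * (Y'.card : ℝ)) := by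
        refine sum_le_sum fun Y _ => ?_
        calc ‖∑ 𝒞 ∈ L.powerset with 𝒞.biUnion id = Y, Φ 𝒞‖ * Real.exp (τ * Y.card)
            ≤ (∑ 𝒞 ∈ L.powerset with 𝒞.biUnion id = Y, ‖Φ 𝒞‖) * Real.exp (τ * Y.card) :=
              mul_le_mul_of_nonneg_right (norm_sum_le _ _) (exp_pos _).le
          _ = ∑ 𝒞 ∈ L.powerset with 𝒞.biUnion id = Y, ‖Φ 𝒞‖ * Real.exp (τ * Y.card) := sum_mul _ _ _
          _ ≤ _ := sum_le_sum fun 𝒞 h𝒞 => mul_le_mul_of_nonneg_left (exp_le_exp.2 (by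
              rw [← mul_sum]
              exact mul_le_mul_of_nonneg_left (card_le_clusterSize_of_biUnion_eq (mem_filter.1 h𝒞).2) hτ)) (norm_nonneg _)
    _ = ∑ 𝒞 ∈ L.powerset with 𝒞.biUnion id ∈ T.filter (fun Y => p ∈ Y), ‖Φ 𝒞‖ * Real.exp (∑ Y' ∈ 𝒞, τ * (Y'.card : ℝ)) :=
        sum_fiberwise_eq_sum_filter _ _ _ _
    _ ≤ ∑ 𝒞 ∈ L.powerset with KPTouches (GeomInc R) 𝒞 {p}, ‖Φ 𝒞‖ * Real.exp (∑ Y' ∈ 𝒞, τ * (Y'.card : ℝ)) := by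
        refine sum_le_sum_of_subset_of_nonneg (fun 𝒞 h𝒞 => ?_) fun _ _ _ => by positivity
        obtain ⟨h𝒞L, hT⟩ := mem_filter.1 h𝒞
        exact mem_filter.2 ⟨h𝒞L, kpTouches_singleton_of_biUnion_eq rfl (mem_filter.1 hT).2⟩

/-- **THE END — THE OUTPUT NORM PINNED AT `p` IS AT MOST THE INPUT NORM PINNED AT `{p}`**: `R` symmetric, `0 ≤ τ`, the norm-form KP hypothesis on `L` ⟹
for every index family `T` of supports and every cell `p`,
`Σ_{Y∈T, p∈Y}‖K⁺(Y)‖e^{τ#Y} ≤ Σ_{Y'∈L, Y' ≁ {p}}‖z Y'‖e^{#Y'+τ#Y'}` — the step is LINEAR from weight `1+τ` to weight `τ`, with constant ONE per pin.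
[folklore] -/
theorem outputNorm_le_inputNorm (hR : ∀ x y, R x y → R y x) (hτ : 0 ≤ τ) {L : Finset (Finset V)}
    (hKP : ∀ Y ∈ L, ∑ Y' ∈ L with GeomInc R Y' Y, ‖z Y'‖ * Real.exp ((Y'.card : ℝ) + τ * (Y'.card : ℝ)) ≤ (Y.card : ℝ))
    (T : Finset (Finset V)) (p : V) :
    ∑ Y ∈ T with p ∈ Y, ‖∑ 𝒞 ∈ L.powerset with 𝒞.biUnion id = Y, truncatedWeight (GeomInc R) z 𝒞‖ * Real.exp (τ * Y.card) ≤
      ∑ Y' ∈ L with GeomInc R Y' {p}, ‖z Y'‖ * Real.exp ((Y'.card : ℝ) + τ * (Y'.card : ℝ)) :=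
  (sum_weighted_supportTerm_le_touchSum hτ L T p).trans (touchSum_le_pinnedNorm hR hτ hKP {p})

/-- **THE OUTPUT NORM PINNED AT A CELL IS AT MOST `η`** under the uniform input bound `sup_q N_{1+τ}(q) ≤ η ≤ 1` (nonempty polymers). [folklore] -/
theorem outputNorm_le_of_uniform (hR : ∀ x y, R x y → R y x) (hτ : 0 ≤ τ) {L : Finset (Finset V)} (hL : ∀ Y ∈ L, Y.Nonempty)
    (hN : ∀ q : V, ∑ Y' ∈ L with Touches R Y' {q}, ‖z Y'‖ * Real.exp ((1 + τ) * (Y'.card : ℝ)) ≤ η) (hη : η ≤ 1)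
    (T : Finset (Finset V)) (p : V) :
    ∑ Y ∈ T with p ∈ Y, ‖∑ 𝒞 ∈ L.powerset with 𝒞.biUnion id = Y, truncatedWeight (GeomInc R) z 𝒞‖ * Real.exp (τ * Y.card) ≤ η := by
  refine (outputNorm_le_inputNorm hR hτ (normKP_of_uniform hτ hL hN hη) T p).trans ?_
  have hform : ∀ Y' : Finset V, (Y'.card : ℝ) + τ * (Y'.card : ℝ) = (1 + τ) * (Y'.card : ℝ) := fun Y' => by ring
  simp_rw [hform]
  -- an incompatible polymer of the singleton touches it
  refine le_trans (sum_le_sum_of_subset_of_nonneg (fun Y' hY' => mem_filter.2 ⟨(mem_filter.1 hY').1, ?_⟩) fun _ _ _ => by positivity) (hN p)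
  obtain ⟨q, hq, hqt⟩ := exists_touches_singleton_of_geomInc (singleton_nonempty p) (mem_filter.1 hY').2
  rw [mem_singleton.1 hq] at hqt
  exact hqt

/-- **THE END — THE OUTPUT IN THE INPUT'S OWN NORM, ONE UNIT OF WEIGHT LOWER**: `R` symmetric with `≤ Δ` neighbours, `0 ≤ τ`, nonempty polymers,
`sup_q Σ_{Y'∈L touching {q}}‖z Y'‖e^{(1+τ)#Y'} ≤ η ≤ 1` ⟹ for every index family `T` and every cell `q`,
`Σ_{Y∈T touching {q}}‖K⁺(Y)‖e^{τ#Y} ≤ (Δ+1)·η` (a support touching `{q}` contains `q` or a neighbour of `q`). [folklore] -/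
theorem outputTouchNorm_le (hR : ∀ x y, R x y → R y x) (hΔ : ∀ x, (nbr x).card ≤ Δ) (hnbr : ∀ x y, R x y → y ∈ nbr x) (hτ : 0 ≤ τ)
    {L : Finset (Finset V)} (hL : ∀ Y ∈ L, Y.Nonempty)
    (hN : ∀ q : V, ∑ Y' ∈ L with Touches R Y' {q}, ‖z Y'‖ * Real.exp ((1 + τ) * (Y'.card : ℝ)) ≤ η) (hη : η ≤ 1)
    (T : Finset (Finset V)) (q : V) :
    ∑ Y ∈ T with Touches R Y {q}, ‖∑ 𝒞 ∈ L.powerset with 𝒞.biUnion id = Y, truncatedWeight (GeomInc R) z 𝒞‖ * Real.exp (τ * Y.card) ≤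
      ((Δ : ℝ) + 1) * η := by
  set g : Finset V → ℝ := fun Y => ‖∑ 𝒞 ∈ L.powerset with 𝒞.biUnion id = Y, truncatedWeight (GeomInc R) z 𝒞‖ * Real.exp (τ * Y.card)
    with hg
  have hg0 : ∀ Y, 0 ≤ g Y := fun Y => by positivity
  have hη0 : 0 ≤ η := le_trans (sum_nonneg fun _ _ => by positivity) (hN q)
  set Nq : Finset V := insert q (nbr q) with hNq
  -- a support touching `{q}` contains a cell of the closed neighbourhood of `q`
  have hsub : T.filter (fun Y => Touches R Y {q}) ⊆ T.filter (fun Y => ∃ q' ∈ Nq, q' ∈ Y) := fun Y hY => by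
    obtain ⟨hYT, w, hw, x, hx, hwx⟩ := mem_filter.1 hY
    rw [mem_singleton] at hx
    subst hx
    refine mem_filter.2 ⟨hYT, ?_⟩
    rcases hwx with rfl | hr
    · exact ⟨w, mem_insert_self _ _, hw⟩
    · exact ⟨w, mem_insert_of_mem (hnbr _ _ (hR _ _ hr)), hw⟩
  calc ∑ Y ∈ T with Touches R Y {q}, g Y ≤ ∑ Y ∈ T with ∃ q' ∈ Nq, q' ∈ Y, g Y := sum_le_sum_of_subset_of_nonneg hsub fun _ _ _ => hg0 _
    _ ≤ ∑ Y ∈ T with ∃ q' ∈ Nq, q' ∈ Y, ∑ q' ∈ Nq with q' ∈ Y, g Y := by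
        refine sum_le_sum fun Y hY => ?_
        obtain ⟨q', hq'N, hq'Y⟩ := (mem_filter.1 hY).2
        have hmem : q' ∈ Nq.filter fun q' => q' ∈ Y := mem_filter.2 ⟨hq'N, hq'Y⟩
        calc g Y = ∑ q'' ∈ ({q'} : Finset V), g Y := by simp
          _ ≤ _ := sum_le_sum_of_subset_of_nonneg (by simpa using hmem) fun _ _ _ => hg0 _
    _ ≤ ∑ Y ∈ T, ∑ q' ∈ Nq with q' ∈ Y, g Y := sum_le_sum_of_subset_of_nonneg (filter_subset _ _) fun _ _ _ => sum_nonneg fun _ _ => hg0 _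
    _ = ∑ q' ∈ Nq, ∑ Y ∈ T with q' ∈ Y, g Y := by
        rw [sum_comm' (t' := Nq) (s' := fun q' => T.filter fun Y => q' ∈ Y)]
        intro Y q'
        simp only [mem_filter]
        tauto
    _ ≤ ∑ _q' ∈ Nq, η := sum_le_sum fun q' _ => outputNorm_le_of_uniform hR hτ hL hN hη T q'
    _ = Nq.card * η := by rw [sum_const, nsmul_eq_mul]
    _ ≤ ((Δ : ℝ) + 1) * η := by
        refine mul_le_mul_of_nonneg_right ?_ hη0
        have h := (card_insert_le q (nbr q)).trans (Nat.add_le_add_right (hΔ q) 1)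
        exact_mod_cast h

/-! ## §3. Toy -/

omit [DecidableEq V] [DecidableRel R] in
/-- Toy (§1): `{a}` is incompatible with the nonempty `{a}`, and touches the singleton `{a}`. -/
example (a : V) : ∃ q ∈ ({a} : Finset V), Touches R {a} {q} :=
  exists_touches_singleton_of_geomInc (singleton_nonempty a) (Or.inl rfl)

end Summit.QuantumFields.BalabanUV.T4Continuum.NE7b.SupStepKPNormLinear
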